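import Mathlib.RingTheory.Ideal.Operations
import Mathlib.RingTheory.Ideal.Span
import HarnessLib

/-!
# Route `ErratumRoadFive`, crux `IMCDivAtErratumDataAll` (item stmt-BirchSwinnertonDyer-19270),
# stub `stub_imcDivErratum_nonsplitAtP` (S1, `a_p = −1`): the ALGEBRAIC SKELETON of the
# ordinary-to-Greenberg transfer brick (R4♯) of the base-change road — the one-sided divisibility
# passes from the ordinary side to the Greenberg/BDP side by cancellation in a domain, kernel-checked

Cell `bsd-stepL` (run/shared/lean/pub/bsd-stepL/), seat `bsd-stepL-imc24a` g2 (PART 1b ACCEL seat (1),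
plan g25 ACCEL-LIST: «base-change JSW17 … IMC to the erratum datum, ♭-normalised (BCS25 road)»).
HONEST FRAMING: nothing here proves or refutes the crux and no BSD statement is touched. The
base-change road to S1 (seat memo `MEMO-imc24a-basechange.md` + the g2 addendum, item evidence on
stmt-BirchSwinnertonDyer-19270; cell memo PROOF-BDP §30) has exactly one brick with no printed
`p ∥ N` form, (R4♯): "a one-sided divisibility `(L_p^PR) ⊇ ch(X_ord)` over the two-variable algebra
`Λ_K` implies `(L_p^Gr) ⊇ ch(X_Gr)`" — Burungale–Skinner–Tian–Wan, arXiv:2409.01350, Part II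
Prop. 1.18 (stated for `p ∤ 2N`, (coprime)), used by Burungale–Castella–Skinner, IMRN 2025 =
arXiv:2405.00270, Thm. 4.1.3 / Cor. 4.1.4. Its PROOF (loc. cit., proof of Prop. 1.18) is two
four-term exact sequences of torsion `Λ`-modules coming from Poitou–Tate duality and the two explicit
reciprocity laws of the two-variable zeta element `𝒵`,
`0 → H¹_{rel,ord}/Λ·𝒵 → Λ^{ur}/(L_p^{Gr}) → X_{Gr} → X_{st,ord} → 0` and
`0 → H¹_{rel,ord}/Λ·𝒵 → Λ/(L_p) → X_{ord} → X_{st,ord} → 0`,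
followed by multiplicativity of characteristic ideals and CANCELLATION. This file is that last step
and nothing else: writing `j`, `c` for generators of `ch(H¹_{rel,ord}/Λ·𝒵)`, `ch(X_{st,ord})`,
`xo`, `xg` for generators of `ch(X_ord)`, `ch(X_Gr)` and `lo`, `lg` for the two `p`-adic
`L`-functions, the sequences give `xg·j ~ lg·c` and `xo·j ~ lo·c` (associates), and then
`lo ∣ xo ⇒ lg ∣ xg` (and conversely, and for the opposite divisibility) as soon as `j ≠ 0` and the
cancelled factor is non-zero — in ANY cancellative commutative monoid with zero, in particular in
the UFDs `Λ_K = ℤ_p⟦T₁,T₂⟧`, `Λ_K^{ur}`, `𝓞_{ℂ_p}⟦T⟧`. So the CONTENT of (R4♯) at a multiplicative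
prime is entirely in its inputs (the zeta element, the two reciprocity laws, the rank-one statement
(rk) and the non-vanishing (nv)), none of which is a tree object today; the memo addendum records
which of them have printed `p ∥ N` forms. The ideal-theoretic corollary is stated in the direction
the stub S1 uses (`Ch ≤ span {Q}`, i.e. `Q ∣ Ch`).

## Contents (all PROVED, elementary; no named fact, no `sorry`)

* `ZetaTransfer.dvd_of_mul_eq_mul` — exact-equality form: `xo·j = lo·c`, `xg·j = lg·c`, `j ≠ 0`,
  `lo ≠ 0`, `lo ∣ xo` ⊢ `lg ∣ xg`.
* `ZetaTransfer.dvd_of_associated` — the same with the two identities up to units (the form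
  characteristic ideals give); `ZetaTransfer.dvd_of_associated'` — the opposite divisibility
  (`xo ∣ lo ⊢ xg ∣ lg`, needs `xo ≠ 0`, `c ≠ 0`); `ZetaTransfer.dvd_iff_dvd_of_associated` — the
  equivalence when all six quantities are non-zero; `ZetaTransfer.associated_of_associated` — the
  equality (main-conjecture) form.
* `ZetaTransfer.span_le_span_of_mul_eq_mul` — principal-ideal form in a commutative domain:
  `(xo)(j) = (lo)(c)`, `(xg)(j) = (lg)(c)`, `j ≠ 0`, `lo ≠ 0`, `(xo) ≤ (lo)` ⊢ `(xg) ≤ (lg)`.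

References: [BurungaleSkinnerTianWan2024] Part II Prop. 1.18 and its proof (arXiv:2409.01350,
§II.1.3.2, the displays (exv), (exvc2)); [BurungaleCastellaSkinner2025] Thm. 4.1.3, Cor. 4.1.4
(arXiv:2405.00270 p. 8: "building on a pair of four-term exact sequences coming from Poitou–Tate
duality"); [CastellaGrossiSkinner2025] Prop. 3.2.1 (the same equivalence at a good ordinary prime).
-/

namespace Summit.BirchSwinnertonDyer.Rank1Residual.X11b.ZetaTransfer

section Monoid

variable {M : Type*} [CommMonoidWithZero M] [IsCancelMulZero M] {xo xg lo lg j c : M}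

/-- **One-sided transfer, exact form.** If `xo·j = lo·c` and `xg·j = lg·c` with `j ≠ 0`,
`lo ≠ 0`, then `lo ∣ xo` implies `lg ∣ xg` (write `xo = lo·a`, cancel `lo` to get `c = a·j`,
then cancel `j`). The algebraic skeleton of BSTW Prop. 1.18 ("a one-sided divisibility in one of
the Conjectures (St), (Greenberg) and (LLZ) implies the analogous divisibility in the other").
[cite: BurungaleSkinnerTianWan2024, Part II Prop. 1.18, proof (arXiv:2409.01350 §II.1.3.2)] -/
theorem dvd_of_mul_eq_mul (h₁ : xo * j = lo * c) (h₂ : xg * j = lg * c) (hj : j ≠ 0)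
    (hlo : lo ≠ 0) (h : lo ∣ xo) : lg ∣ xg := by
  obtain ⟨a, rfl⟩ := h
  have hc : c = a * j := mul_left_cancel₀ hlo (by rw [← h₁, mul_assoc])
  refine ⟨a, mul_right_cancel₀ hj ?_⟩
  rw [h₂, hc, mul_assoc]

/-- **One-sided transfer, up to units** (the form in which characteristic ideals, defined up to
units of `Λ`, deliver the two four-term identities): `xo·j ~ lo·c`, `xg·j ~ lg·c`, `j ≠ 0`,
`lo ≠ 0` and `lo ∣ xo` give `lg ∣ xg`.
[cite: BurungaleSkinnerTianWan2024, Part II Prop. 1.18, proof (arXiv:2409.01350 §II.1.3.2)]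
[cite: BurungaleCastellaSkinner2025, Thm. 4.1.3 (arXiv:2405.00270 p. 8)] -/
theorem dvd_of_associated (h₁ : Associated (xo * j) (lo * c)) (h₂ : Associated (xg * j) (lg * c))
    (hj : j ≠ 0) (hlo : lo ≠ 0) (h : lo ∣ xo) : lg ∣ xg := by
  obtain ⟨a, rfl⟩ := h
  -- cancel `lo`: `a·j ~ c`
  have hc : Associated (a * j) c :=
    Associated.of_mul_left (by simpa [mul_assoc] using h₁) (Associated.refl lo) hlo
  -- `xg·j ~ lg·c ~ lg·(a·j) = (lg·a)·j`, cancel `j`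
  have h₃ : Associated (xg * j) (lg * a * j) := by
    simpa [mul_assoc] using h₂.trans ((Associated.refl lg).mul_mul hc.symm)
  have h₄ : Associated xg (lg * a) := Associated.of_mul_right h₃ (Associated.refl j) hj
  exact dvd_trans (dvd_mul_right lg a) h₄.symm.dvd

/-- **The opposite divisibility transfers too** ("The same conclusion holds for the opposite
divisibilities", BCS Thm. 4.1.3): `xo·j ~ lo·c`, `xg·j ~ lg·c`, `xo ≠ 0`, `c ≠ 0` and `xo ∣ lo`
give `xg ∣ lg`. [cite: BurungaleCastellaSkinner2025, Thm. 4.1.3 (arXiv:2405.00270 p. 8)] -/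
theorem dvd_of_associated' (h₁ : Associated (xo * j) (lo * c)) (h₂ : Associated (xg * j) (lg * c))
    (hxo : xo ≠ 0) (hc : c ≠ 0) (h : xo ∣ lo) : xg ∣ lg := by
  obtain ⟨b, rfl⟩ := h
  -- cancel `xo`: `j ~ b·c`
  have hj : Associated j (b * c) :=
    Associated.of_mul_left (by simpa [mul_assoc] using h₁) (Associated.refl xo) hxo
  -- `(xg·b)·c = xg·(b·c) ~ xg·j ~ lg·c`, cancel `c`
  have h₃ : Associated (xg * b * c) (lg * c) := by
    simpa [mul_assoc] using ((Associated.refl xg).mul_mul hj).symm.trans h₂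
  have h₄ : Associated (xg * b) lg := Associated.of_mul_right h₃ (Associated.refl c) hc
  exact dvd_trans (dvd_mul_right xg b) h₄.dvd

/-- **Equivalence of the two one-sided divisibilities** when the six quantities are non-zero (the
situation of BSTW Prop. 1.18 under (van_L): torsion Selmer groups, non-zero `p`-adic `L`-functions,
`𝒵` non-torsion): `lo ∣ xo ↔ lg ∣ xg`. The hypotheses are symmetric in (`o` ↔ `g`), so both
directions are `dvd_of_associated`. [cite: BurungaleSkinnerTianWan2024, Part II Prop. 1.18 (arXiv:2409.01350 §II.1.3.2)] -/
theorem dvd_iff_dvd_of_associated (h₁ : Associated (xo * j) (lo * c))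
    (h₂ : Associated (xg * j) (lg * c)) (hj : j ≠ 0) (hlo : lo ≠ 0) (hlg : lg ≠ 0) :
    lo ∣ xo ↔ lg ∣ xg :=
  ⟨dvd_of_associated h₁ h₂ hj hlo, dvd_of_associated h₂ h₁ hj hlg⟩

/-- **Equality form** ("In particular, Conjecture 4.1.1 and Conjecture 4.1.2 are equivalent", BCS
Thm. 4.1.3): if `xo ~ lo` (the ordinary main conjecture) then `xg ~ lg` (the Greenberg one), given
`j ≠ 0`, `lo ≠ 0`, `c ≠ 0`. [cite: BurungaleCastellaSkinner2025, Thm. 4.1.3 (arXiv:2405.00270 p. 8)] -/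
theorem associated_of_associated (h₁ : Associated (xo * j) (lo * c))
    (h₂ : Associated (xg * j) (lg * c)) (hj : j ≠ 0) (hlo : lo ≠ 0) (hc : c ≠ 0)
    (h : Associated xo lo) : Associated xg lg :=
  associated_of_dvd_dvd (dvd_of_associated' h₁ h₂ (h.ne_zero_iff.mpr hlo) hc h.dvd)
    (dvd_of_associated h₁ h₂ hj hlo h.symm.dvd)

end Monoid

section Ideal

variable {R : Type*} [CommRing R] [IsDomain R] {xo xg lo lg j c : R}

/-- **Principal-ideal form, in the direction stub S1 uses** (`Ch ≤ (Q)`, i.e. `Q ∣ Ch`): in a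
commutative domain, from `(xo)(j) = (lo)(c)` and `(xg)(j) = (lg)(c)` (the two four-term sequences
read on characteristic ideals, all principal in the UFD `Λ_K`), `j ≠ 0`, `lo ≠ 0` and
`(xo) ≤ (lo)` (the ordinary-side divisibility `L_p^PR ∣ ch(X_ord)`) conclude `(xg) ≤ (lg)` (the
Greenberg-side divisibility `L_p^Gr ∣ ch(X_Gr)`).
[cite: BurungaleSkinnerTianWan2024, Part II Prop. 1.18 (arXiv:2409.01350 §II.1.3.2)]
[cite: BurungaleCastellaSkinner2025, Thm. 4.1.3, Cor. 4.1.4 (arXiv:2405.00270 p. 8)] -/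
theorem span_le_span_of_mul_eq_mul
    (h₁ : Ideal.span {xo} * Ideal.span {j} = Ideal.span {lo} * Ideal.span ({c} : Set R))
    (h₂ : Ideal.span {xg} * Ideal.span {j} = Ideal.span {lg} * Ideal.span ({c} : Set R))
    (hj : j ≠ 0) (hlo : lo ≠ 0) (h : Ideal.span ({xo} : Set R) ≤ Ideal.span {lo}) :
    Ideal.span ({xg} : Set R) ≤ Ideal.span {lg} := by
  rw [Ideal.span_singleton_mul_span_singleton, Ideal.span_singleton_mul_span_singleton,
    Ideal.span_singleton_eq_span_singleton] at h₁ h₂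
  rw [Ideal.span_singleton_le_span_singleton] at h ⊢
  exact dvd_of_associated h₁ h₂ hj hlo h

end Ideal

end Summit.BirchSwinnertonDyer.Rank1Residual.X11b.ZetaTransfer
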